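import Summits.Ventures.PercRepro.MSTightTwinFreeProduct
import Summits.Ventures.PercRepro.ExcessOneNonTightening
import Summits.Ventures.PercRepro.ThetaTwoPairsV2
import Summits.Ventures.PercRepro.MSTightDefect

/-!
# (SING-t) at a removable tight-trace element, part I: the setting and the trace

Dossier proofs/MINE1-theoremS.md, Addendum 36 (Setting, Symmetries, Lemma 1, the removable
case (R1)–(R4), Propositions 1–2) and Addendum 37 §1. A **removable Case I datum**
(`RemovableData F r u`) is a residue instance `(F, u)` of the V lane (an MS-excess-one family
without twins, with empty core and full support, valid, `∅, univ ∉ F`, `u, ū ∉ F`, every member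
A- or C*-signable, `F ∪ {u}` not tight) together with an element `r ∈ u` whose trace
`P = proj r F` is tight, which is REMOVABLE (`partr r F ⊆ part0 r F`: every member through `r`
stays a member without `r`), in Case I (`u.erase r ∈ F`), and at which `{r} ∉ F` and
`univ.erase r ∉ F` (the trace is a GENUINE product). Theorem (SING-t) at removable elements says
such a datum does not exist.

This module records the trace facts: `P` is tight and twin-free, so its differences `D` form a
down-set and Theorem S applies in the flip form with `R = R*(P)` (MSTightTwinFreeProduct.lean);
`F₀ = P`, `K = partner r F = partr r F`, `X = D` and `|Y| = |K| + 1` (the excess at the tight trace);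
`Y = D ∩ ↓K` ((R1)); the genuine-product facts `R ∉ D`, `N = S' ∖ R ∉ D`; `u₁ = u.erase r ∈ P`;
`ū = univ ∖ u ∉ P`; and the translation of the signability cells of a member `p ∈ P`
(`cells_iff_A`, `cells_iff_C`).
-/

namespace PercRepro.MSTight

open Finset
open scoped FinsetFamily

variable {α : Type*} [DecidableEq α] [Fintype α]

/-- A residue instance `(F, u)` with a removable tight-trace element `r ∈ u` in Case I, at which
the trace is a genuine product (the hypotheses of (SING-t), removable case, by contradiction). -/
structure RemovableData (F : Finset (Finset α)) (r : α) (u : Finset α) : Prop where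
  /-- MS-excess one -/
  hexc : (F \\ F).card = F.card + 1
  /-- the trace at `r` is tight -/
  hP : Tight (proj r F)
  /-- no twins -/
  htf : ∀ a b, Twin F a b → a = b
  /-- empty core -/
  hcore : ∀ a, ∃ t ∈ F, a ∉ t
  /-- full support -/
  hsupp : ∀ a, ∃ t ∈ F, a ∈ t
  /-- `∅ ∉ F` -/
  hempty : (∅ : Finset α) ∉ F
  /-- `univ ∉ F` -/
  huniv : (univ : Finset α) ∉ F
  /-- valid: no complementary pair -/
  hvalid : ∀ t ∈ F, univ \ t ∉ F
  /-- `u ∉ F` -/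
  hu : u ∉ F
  /-- `ū ∉ F` -/
  hu' : univ \ u ∉ F
  /-- every member is A- or C*-signable -/
  hsig : ∀ t ∈ F, Cells (F \\ F) t u ∨ Cells (F \\ F) t (univ \ u)
  /-- `F ∪ {u}` is not tight -/
  hnt : ¬ Tight (insert u F)
  /-- `r ∈ u` -/
  hru : r ∈ u
  /-- `r` is removable -/
  hrem : partr r F ⊆ part0 r F
  /-- Case I: `u ∖ r ∈ F` -/
  hI : u.erase r ∈ F
  /-- `{r} ∉ F` -/
  hgen1 : ({r} : Finset α) ∉ F
  /-- `univ ∖ r ∉ F` -/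
  hgen2 : univ.erase r ∉ F

namespace RemovableData

variable {F : Finset (Finset α)} {r : α} {u : Finset α}

/-- The members of the trace lie inside `S' = univ.erase r`. -/
theorem subset_erase_of_mem_proj {r : α} {F : Finset (Finset α)} {p : Finset α} (hp : p ∈ proj r F) :
    p ⊆ univ.erase r := by
  obtain ⟨t, -, rfl⟩ := mem_proj.1 hp
  exact erase_subset_erase r (subset_univ t)

/-- `F₀ = P`: the trace is the family of members avoiding `r`. -/
theorem part0_eq_proj (d : RemovableData F r u) : part0 r F = proj r F := by
  rw [proj_eq_union, union_eq_left.2 d.hrem]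

/-- `K = F₁`: the partner family is the family of members through `r`, with `r` removed. -/
theorem partner_eq_partr (d : RemovableData F r u) : partner r F = partr r F := by
  rw [partner, inter_eq_right.2 d.hrem]

/-- Members of the trace are members of `F`. -/
theorem mem_of_mem_proj (d : RemovableData F r u) {p : Finset α} (hp : p ∈ proj r F) : p ∈ F := by
  rw [← d.part0_eq_proj] at hp
  exact (mem_part0.1 hp).1

/-- Members of the trace avoid `r`. -/
theorem notMem_of_mem_proj (d : RemovableData F r u) {p : Finset α} (hp : p ∈ proj r F) : r ∉ p := by
  rw [← d.part0_eq_proj] at hp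
  exact (mem_part0.1 hp).2

/-- `insert r k ∈ F` for every partner member `k`. -/
theorem insert_mem_of_mem_partner (d : RemovableData F r u) {k : Finset α}
    (hk : k ∈ partner r F) : insert r k ∈ F := by
  rw [d.partner_eq_partr] at hk
  exact (mem_partr.1 hk).2

/-- Partner members avoid `r`. -/
theorem notMem_of_mem_partner (d : RemovableData F r u) {k : Finset α}
    (hk : k ∈ partner r F) : r ∉ k := by
  rw [d.partner_eq_partr] at hk
  exact (mem_partr.1 hk).1

/-- Partner members are members of the trace. -/
theorem mem_proj_of_mem_partner (d : RemovableData F r u) {k : Finset α}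
    (hk : k ∈ partner r F) : k ∈ proj r F := by
  rw [← d.part0_eq_proj]
  exact (mem_inter.1 hk).1

/-- The trace is twin-free (as a family on `α`): two elements of `S'` are separated by a member of
`F`, and `r` is separated from every `a ≠ r` by a member containing `a` (full support). -/
theorem twinFree_proj (d : RemovableData F r u) : ∀ a b, Twin (proj r F) a b → a = b := by
  -- `r` is a twin of `b` only if `b = r`
  have key : ∀ b, Twin (proj r F) r b → b = r := by
    intro b hb
    by_contra hbr
    obtain ⟨t', ht', hbt'⟩ := d.hsupp b
    have h := hb (t'.erase r) (mem_proj.2 ⟨t', ht', rfl⟩)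
    have : b ∈ t'.erase r := mem_erase.2 ⟨hbr, hbt'⟩
    exact (mem_erase.1 (h.2 this)).1 rfl
  intro a b hab
  by_cases har : a = r
  · rw [har] at hab ⊢
    exact (key b hab).symm
  · by_cases hbr : b = r
    · rw [hbr] at hab ⊢
      exact key a hab.symm
    · apply d.htf
      intro t ht
      have h := hab (t.erase r) (mem_proj.2 ⟨t, ht, rfl⟩)
      constructor
      · intro hat
        exact (mem_erase.1 (h.1 (mem_erase.2 ⟨har, hat⟩))).2
      · intro hbt
        exact (mem_erase.1 (h.2 (mem_erase.2 ⟨hbr, hbt⟩))).2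

/-- The differences of the trace form a down-set. -/
theorem isDownSet_diffs_proj (d : RemovableData F r u) : IsDownSet (proj r F \\ proj r F) :=
  isDownSet_diffs_of_twinFree d.hP d.twinFree_proj

/-- `X = D(P)`: the differences of `F` avoiding `r` are the differences of the trace. -/
theorem diffsX_eq (d : RemovableData F r u) : diffsX r F = proj r F \\ proj r F := by
  apply Subset.antisymm
  · intro E hE
    have := diffs_proj_eq r F
    rw [this]; exact mem_union_left _ hE
  · intro E hE
    rw [← d.part0_eq_proj] at hE
    exact mem_union_left _ (mem_union_left _ hE)

/-- `|Y| = |K| + 1`: the excess sits at the trace. -/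
theorem card_diffsY (d : RemovableData F r u) : (diffsY r F).card = (partner r F).card + 1 := by
  have h1 := card_diffs_eq_card_X_add_card_Y r F
  have h2 := card_eq_card_proj_add_card_partner r F
  have h3 : (diffsX r F).card = (proj r F).card := by rw [d.diffsX_eq]; exact d.hP
  have h4 := d.hexc
  omega

omit [Fintype α] in
/-- `Y ⊆ D(P)`. -/
theorem diffsY_subset : diffsY r F ⊆ proj r F \\ proj r F := by
  intro E hE
  have := diffs_proj_eq r F
  rw [this]; exact mem_union_right _ hE

/-- **(R1).** `Y = D(P) ∩ ↓K`: a difference of the trace below a partner member is a difference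
through `r`. -/
theorem mem_diffsY_iff_faces (d : RemovableData F r u) {z : Finset α} :
    z ∈ diffsY r F ↔ z ∈ proj r F \\ proj r F ∧ ∃ k ∈ partner r F, z ⊆ k := by
  constructor
  · intro hz
    refine ⟨diffsY_subset hz, ?_⟩
    obtain ⟨k, hk, p, -, rfl⟩ := mem_diffs.1 hz
    rw [← d.partner_eq_partr] at hk
    exact ⟨k, hk, sdiff_subset⟩
  · rintro ⟨hz, k, hk, hzk⟩
    -- `z = k \ p` with `p = (x_k \ x_z) ∪ (R \ (z ∩ R))`
    have hD := d.isDownSet_diffs_proj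
    have hkP := d.mem_proj_of_mem_partner hk
    obtain ⟨hkN, hkR⟩ := (mem_iff_parts d.hP).1 hkP
    obtain ⟨hzN, hzR⟩ := (mem_diffs_iff_parts d.hP hD).1 hz
    have hp : (k \ Rstar (proj r F)) \ (z \ Rstar (proj r F)) ∪
        (Rstar (proj r F) \ (z ∩ Rstar (proj r F))) ∈ proj r F :=
      union_sdiff_mem d.hP (hD _ hkN _ sdiff_subset)
        (disjoint_of_subset_left sdiff_subset disjoint_sdiff_self_left) hzR inter_subset_right
    have hp0 : (k \ Rstar (proj r F)) \ (z \ Rstar (proj r F)) ∪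
        (Rstar (proj r F) \ (z ∩ Rstar (proj r F))) ∈ part0 r F := by
      rw [d.part0_eq_proj]; exact hp
    have hk' : k ∈ partr r F := by rw [← d.partner_eq_partr]; exact hk
    refine mem_diffs.2 ⟨k, hk', _, hp0, ?_⟩
    ext a
    have hzk' := @hzk a
    simp only [mem_sdiff, mem_union, mem_inter]
    tauto

section Genuine

/-- `∅ ∉ P` (as `∅ ∉ F` and `{r} ∉ F`). -/
theorem empty_notMem_proj (d : RemovableData F r u) : (∅ : Finset α) ∉ proj r F := by
  intro h
  rcases mem_union.1 ((proj_eq_union r F) ▸ h) with h0 | h1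
  · exact d.hempty (mem_part0.1 h0).1
  · have := (mem_partr.1 h1).2
    rw [insert_empty] at this
    exact d.hgen1 this

/-- `S' ∉ P` (as `S' ∉ F` and `univ ∉ F`). -/
theorem erase_notMem_proj (d : RemovableData F r u) : univ.erase r ∉ proj r F := by
  intro h
  rcases mem_union.1 ((proj_eq_union r F) ▸ h) with h0 | h1
  · exact d.hgen2 (mem_part0.1 h0).1
  · have := (mem_partr.1 h1).2
    rw [insert_erase (mem_univ r)] at this
    exact d.huniv this

/-- **Genuine product, `M`-side:** `R ∉ D` (`∅ ∉ U`). -/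
theorem Rstar_notMem_diffs (d : RemovableData F r u) :
    Rstar (proj r F) ∉ proj r F \\ proj r F := by
  intro h
  apply d.empty_notMem_proj
  rw [mem_iff_parts d.hP]
  refine ⟨?_, by rwa [sdiff_empty]⟩
  rw [empty_sdiff]
  exact d.isDownSet_diffs_proj _ h _ (empty_subset _)

/-- **Genuine product, `N`-side:** `N = S' ∖ R ∉ D` (`N ∉ L`). -/
theorem sdiff_Rstar_notMem_diffs (d : RemovableData F r u) :
    univ.erase r \ Rstar (proj r F) ∉ proj r F \\ proj r F := by
  intro h
  apply d.erase_notMem_proj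
  rw [mem_iff_parts d.hP]
  refine ⟨h, ?_⟩
  have hRS : Rstar (proj r F) ⊆ univ.erase r := by
    have hR := Rstar_mem_of_dichotomy (dichotomy_of_tight d.hP) ⟨_, mem_proj.2 ⟨_, d.hI, rfl⟩⟩
    exact subset_erase_of_mem_proj hR
  rw [sdiff_eq_empty_iff_subset.2 hRS]
  exact d.isDownSet_diffs_proj _ h _ (empty_subset _)

/-- `R ∈ P`, hence `R ⊆ S'`. -/
theorem Rstar_mem_proj (d : RemovableData F r u) : Rstar (proj r F) ∈ proj r F :=
  Rstar_mem_of_dichotomy (dichotomy_of_tight d.hP) ⟨_, mem_proj.2 ⟨_, d.hI, rfl⟩⟩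

/-- `R ⊆ S'`. -/
theorem Rstar_subset_erase (d : RemovableData F r u) : Rstar (proj r F) ⊆ univ.erase r :=
  subset_erase_of_mem_proj d.Rstar_mem_proj

/-- Every singleton of `S'` is a difference of the trace. -/
theorem singleton_mem_diffs (d : RemovableData F r u) {a : α} (ha : a ≠ r) :
    ({a} : Finset α) ∈ proj r F \\ proj r F := by
  obtain ⟨t, ht, hat⟩ := d.hsupp a
  obtain ⟨t', ht', hat'⟩ := d.hcore a
  refine d.isDownSet_diffs_proj _ (mem_diffs.2 ⟨t.erase r, mem_proj.2 ⟨t, ht, rfl⟩, t'.erase r,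
    mem_proj.2 ⟨t', ht', rfl⟩, rfl⟩) _ ?_
  intro b hb
  rw [mem_singleton] at hb
  subst hb
  exact mem_sdiff.2 ⟨mem_erase.2 ⟨ha, hat⟩, fun h => hat' (mem_erase.1 h).2⟩

end Genuine

section CaseI

/-- `u₁ = u.erase r ∈ P`. -/
theorem erase_mem_proj (d : RemovableData F r u) : u.erase r ∈ proj r F :=
  mem_proj.2 ⟨u.erase r, d.hI, erase_idem⟩

/-- `u₁ ∈ F₀`: `u.erase r` is a member avoiding `r`. -/
theorem erase_mem_part0 (d : RemovableData F r u) : u.erase r ∈ part0 r F :=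
  mem_part0.2 ⟨d.hI, notMem_erase r u⟩

/-- `ū = univ ∖ u ∉ P`: `ū ∈ F₀` is `ū ∈ F`, `ū ∈ F₁` means `insert r ū = univ ∖ (u ∖ r) ∈ F`,
complementary to `u ∖ r ∈ F`. -/
theorem compl_notMem_proj (d : RemovableData F r u) : univ \ u ∉ proj r F := by
  intro h
  rcases mem_union.1 ((proj_eq_union r F) ▸ h) with h0 | h1
  · exact d.hu' (mem_part0.1 h0).1
  · have h2 := (mem_partr.1 h1).2
    have : insert r (univ \ u) = univ \ u.erase r := by
      ext a
      simp only [mem_insert, mem_sdiff, mem_univ, true_and, mem_erase, not_and]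
      constructor
      · rintro (rfl | h')
        · exact fun h'' => absurd rfl h''
        · exact fun _ => h'
      · intro h'
        by_cases har : a = r
        · exact Or.inl har
        · exact Or.inr (h' har)
    rw [this] at h2
    exact d.hvalid _ d.hI h2

/-- `u₁ ⊆ S'` and `r ∉ u₁`. -/
theorem erase_subset_erase' (u : Finset α) (r : α) : u.erase r ⊆ univ.erase r :=
  erase_subset_erase r (subset_univ u)

end CaseI

section Cells

/-- The agreement cells of `v` at `t`, written with set differences. -/
theorem cells_iff {D : Finset (Finset α)} {t v : Finset α} :
    Cells D t v ↔ t ∩ v ∈ D ∧ univ \ (t ∪ v) ∈ D := by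
  unfold Cells
  rw [← sdiff_union_distrib]

/-- **A-signability of a member `p` avoiding `r`** (`r ∈ u`): `p ∩ u₁ ∈ D(P)` and
`ū ∖ p ∈ D(P)` (both cells avoid `r`, so they are differences of the trace). -/
theorem cells_A_iff (d : RemovableData F r u) {p : Finset α} (hp : p ∈ proj r F) :
    Cells (F \\ F) p u ↔ p ∩ u.erase r ∈ proj r F \\ proj r F ∧
      (univ \ u) \ p ∈ proj r F \\ proj r F := by
  have hrp := d.notMem_of_mem_proj hp
  have e1 : p ∩ u = p ∩ u.erase r := by
    ext a; simp only [mem_inter, mem_erase]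
    constructor
    · rintro ⟨hap, hau⟩; exact ⟨hap, fun h => hrp (h ▸ hap), hau⟩
    · rintro ⟨hap, -, hau⟩; exact ⟨hap, hau⟩
  have e2 : (univ \ p) ∩ (univ \ u) = (univ \ u) \ p := by
    ext a; simp only [mem_inter, mem_sdiff, mem_univ, true_and]; tauto
  unfold Cells
  rw [e1, e2, ← d.diffsX_eq, PercRepro.MSTight.mem_diffsX_iff, PercRepro.MSTight.mem_diffsX_iff]
  constructor
  · rintro ⟨h1, h2⟩
    exact ⟨⟨h1, fun h => hrp (mem_inter.1 h).1⟩, ⟨h2, fun h => (mem_sdiff.1 (mem_sdiff.1 h).1).2 d.hru⟩⟩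
  · rintro ⟨⟨h1, -⟩, ⟨h2, -⟩⟩
    exact ⟨h1, h2⟩

/-- **C*-signability of a member `p` avoiding `r`** (`r ∈ u`): `p ∖ u₁ ∈ D(P)` and `u₁ ∖ p ∈ Y`
(the cell `(univ ∖ p) ∩ u = insert r (u₁ ∖ p)` contains `r`). -/
theorem cells_C_iff (d : RemovableData F r u) {p : Finset α} (hp : p ∈ proj r F) :
    Cells (F \\ F) p (univ \ u) ↔ p \ u.erase r ∈ proj r F \\ proj r F ∧
      u.erase r \ p ∈ diffsY r F := by
  have hrp := d.notMem_of_mem_proj hp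
  have e1 : p ∩ (univ \ u) = p \ u.erase r := by
    ext a; simp only [mem_inter, mem_sdiff, mem_univ, true_and, mem_erase, not_and]
    constructor
    · rintro ⟨hap, hau⟩; exact ⟨hap, fun _ h => hau h⟩
    · rintro ⟨hap, h⟩; exact ⟨hap, fun hau => h (fun h' => hrp (h' ▸ hap)) hau⟩
  have e2 : (univ \ p) ∩ (univ \ (univ \ u)) = insert r (u.erase r \ p) := by
    ext a
    simp only [mem_inter, mem_sdiff, mem_univ, true_and, not_not, mem_insert, mem_erase]
    constructor
    · rintro ⟨hap, hau⟩
      by_cases har : a = r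
      · exact Or.inl har
      · exact Or.inr ⟨⟨har, hau⟩, hap⟩
    · rintro (rfl | ⟨⟨-, hau⟩, hap⟩)
      · exact ⟨hrp, d.hru⟩
      · exact ⟨hap, hau⟩
  unfold Cells
  rw [e1, e2, ← d.diffsX_eq, PercRepro.MSTight.mem_diffsX_iff, PercRepro.MSTight.mem_diffsY_iff]
  constructor
  · rintro ⟨h1, h2⟩
    exact ⟨⟨h1, fun h => hrp (mem_sdiff.1 h).1⟩, ⟨fun h => (mem_erase.1 (mem_sdiff.1 h).1).1 rfl, h2⟩⟩
  · rintro ⟨⟨h1, -⟩, ⟨-, h2⟩⟩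
    exact ⟨h1, h2⟩

end Cells

end RemovableData

end PercRepro.MSTight
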